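import Mathlib
import Literature.MathematicalPhysics.KineticTheory.HardSphereEuler

/-!
# Sketch — crux-ideate round 1, ideator 2, crux `ClampedCurrentsDock` (stmt-AtomisticToContinuum-14680)

First lemmas of the two idea cards of this seat (no skeleton at this stage):

* card `coherence-not-tails`: `flightAbel` (flight-wise Abel summation of the cubic streaming
  channel onto contacts; PROVED), `contactTransfer` (pair form at a contact; PROVED) and the typed
  true-law stub `CoherentSuprathermalContentVanishes` (elaboration only);
* card `clamp-buys-locality`: `bernoulliTiltBound` (messenger sparsity at every tilt; PROVED) and
  `clampLocality` (a clamped particle's window speed excursion; PROVED).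
-/

noncomputable section

open MeasureTheory Set Filter Finset
open scoped ENNReal BigOperators

namespace Summit.AtomisticToContinuum.HydrodynamicLimit.Cruxes.ClampedCurrentsDock.IdeatorTwo

/-! ## Card 1 — `coherence-not-tails` -/

/-- **Flight-wise Abel identity.** Along one particle's piecewise-free trajectory with flights
`k = 0, …, n-1`, inverse temperature `β k` at the START of flight `k` (so `β (k+1)` at its end =
at the `(k+1)`-st contact) and kinetic energy `e k` on flight `k` (constant between contacts), the
cubic streaming channel `Σ_k (β_{k+1} - β_k) e_k` (= `∫ ∇β·v |v|²/2` over the flights) plus the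
contact channel `Σ_k β_{k+1} (e_{k+1} - e_k)` (β AT the contact × energy jump there) telescopes to
the boundary term `β_n e_n - β_0 e_0`.  Pure algebra. -/
theorem flightAbel (β e : ℕ → ℝ) (n : ℕ) :
    (∑ k ∈ range n, (β (k + 1) - β k) * e k) + ∑ k ∈ range n, β (k + 1) * (e (k + 1) - e k)
      = β n * e n - β 0 * e 0 := by
  induction n with
  | zero => simp
  | succ n ih =>
    rw [sum_range_succ, sum_range_succ]
    have : (∑ k ∈ range n, (β (k + 1) - β k) * e k) + ∑ k ∈ range n, β (k + 1) * (e (k + 1) - e k)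
        = β n * e n - β 0 * e 0 := ih
    linear_combination this

/-- **Contact form.** At a contact of particles `i, j` (positions `x_i ≠ x_j`, `|x_i - x_j| = ε_N`)
energy conservation `Δe_j = -Δe_i` turns the two contact terms of `flightAbel` into the
COLLISIONAL β-TRANSFER `(β(x_i) - β(x_j)) Δe_i` — the energy component of the clamped collisional
class of `EquilibriumClampedCollisionalWindowLD`. -/
theorem contactTransfer (βi βj Δei Δej : ℝ) (h : Δej = -Δei) :
    βi * Δei + βj * Δej = (βi - βj) * Δei := by
  subst h; ring

open Literature.MathematicalPhysics.KineticTheory Literature.Analysis.FluidPDE in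
/-- **Typed true-law stub of card `coherence-not-tails`** (the ONE new input of the line; frame of
`EnergyCurrentTails`, stmt-9235).  Peculiar velocity `W = v_i(r) - u_s(x_i(r))` w.r.t. the Euler
velocity at the window's start `s`; window `w = τ (N+1)^{-1/3}`; suprathermal threshold `K⋆`
(chosen after `t`, before `η`); window cubic scale `c_i = w⁻¹ ∫ |W|³`; suprathermal cubic content
`c_i^hi = w⁻¹ ∫ |W|³ 1{|W| > K⋆}`; window-averaged suprathermal fast heat flux
`q̄_i = w⁻¹ ∫ 1{|W| > K⋆} (|W|² - 5 θ_s(x)) W`; particle `i` is `η`-COHERENT on the window iff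
`‖q̄_i‖ > η c_i`.  Statement: the time-integrated coherent suprathermal cubic content per particle
vanishes — `∀ t < T ∃ K⋆ ∀ η ∀ ε ∃ τ₀ ∀ τ ≥ τ₀ ∃ N₀ ∀ N ≥ N₀,
∫₀ᵗ E_λ[(N+1)⁻¹ Σ_i c_i^hi(s) 1{‖q̄_i(s)‖ > η c_i(s)}] ds ≤ ε`. -/
def CoherentSuprathermalContentVanishes : Prop :=
  ∀ (a₀ θ₀ : T3 → ℝ) (u₀ : T3 → V3), Continuous a₀ → Continuous θ₀ → Continuous u₀ →
    (∀ x, 0 < a₀ x) → (∀ x, 0 < θ₀ x) →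
    ∃ σ₀ : ℝ, 0 < σ₀ ∧ ∀ σ : ℝ, 0 < σ → σ < σ₀ →
    ∀ (T : ℝ) (ρ θ : ℝ → T3 → ℝ) (u : ℝ → T3 → V3), IsHardSphereEulerSolution σ T ρ u θ →
    ∀ Φ : (N : ℕ) → HardSphereFlow (Torus.geometry (Fin 3)) (hsDiameter σ N) (N + 1),
    TendstoHydroFieldsAt (fun N => localGibbsLaw σ a₀ u₀ θ₀ N (Φ N)) Φ ρ u θ 0 →
    ∀ t ∈ Set.Ico 0 T, ∃ Kstar : ℝ, 0 < Kstar ∧ ∀ η : ℝ, 0 < η → ∀ ε : ℝ, 0 < ε →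
    ∃ τ₀ : ℝ, 0 < τ₀ ∧ ∀ τ : ℝ, τ₀ ≤ τ → ∃ N₀ : ℕ, ∀ N : ℕ, N₀ ≤ N →
      (let w : ℝ := τ * ((N : ℝ) + 1) ^ (-(1 / 3 : ℝ))
       let P := localGibbsLaw σ a₀ u₀ θ₀ N (Φ N)
       let W := fun (i : Fin (N + 1)) (s r : ℝ) (z : Config (N + 1) (Fin 3) T3) =>
         ((Φ N).flow r z i).2 - u s ((Φ N).flow r z i).1
       let cub := fun (i : Fin (N + 1)) (s : ℝ) (z : Config (N + 1) (Fin 3) T3) =>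
         w⁻¹ * ∫ r in s..(s + w), ‖W i s r z‖ ^ 3
       let cubHi := fun (i : Fin (N + 1)) (s : ℝ) (z : Config (N + 1) (Fin 3) T3) =>
         w⁻¹ * ∫ r in s..(s + w), (if Kstar < ‖W i s r z‖ then ‖W i s r z‖ ^ 3 else 0)
       let qbar := fun (i : Fin (N + 1)) (s : ℝ) (z : Config (N + 1) (Fin 3) T3) =>
         w⁻¹ • ∫ r in s..(s + w),
           (if Kstar < ‖W i s r z‖ then (‖W i s r z‖ ^ 2 - 5 * θ s ((Φ N).flow r z i).1) else 0)
             • W i s r z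
       ∫ s in (0 : ℝ)..t,
          (∫⁻ z, ENNReal.ofReal (((N : ℝ) + 1)⁻¹ * ∑ i : Fin (N + 1),
              (if η * cub i s z < ‖qbar i s z‖ then cubHi i s z else 0)) ∂P).toReal ≤ ε)

/-! ## Card 2 — `clamp-buys-locality` -/

/-- **Messenger sparsity at every tilt.** For independent indicators with success
probabilities `p i ∈ [0,1]` the moment generating function of their sum at tilt `θ ≥ 0` is
`∏ (1 - p_i + p_i e^θ) ≤ exp((e^θ - 1) Σ p_i)`: a Bernoulli count with vanishing mean density has
`o(N)` log-mgf at EVERY fixed tilt (this is what replaces "finite speed of influence"). -/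
theorem bernoulliTiltBound {n : ℕ} (p : Fin n → ℝ) (hp : ∀ i, 0 ≤ p i) (θ : ℝ) (hθ : 0 ≤ θ) :
    ∏ i, (1 - p i + p i * Real.exp θ) ≤ Real.exp ((Real.exp θ - 1) * ∑ i, p i) := by
  have hθ' : 0 ≤ Real.exp θ - 1 := by linarith [Real.add_one_le_exp θ]
  rw [Finset.mul_sum, Real.exp_sum]
  refine Finset.prod_le_prod ?_ ?_
  · intro i _
    have := hp i
    nlinarith [Real.add_one_le_exp θ]
  · intro i _
    have h1 : 1 - p i + p i * Real.exp θ = (Real.exp θ - 1) * p i + 1 := by ring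
    rw [h1]
    exact Real.add_one_le_exp _

/-- **Clamp locality.** If the total collisional impulse of a particle over the window is at most
`A` (the activity clamp `a_i ≤ V` gives `A = Vτ/σ`), then at every intermediate step its velocity
stays within `A` of the initial one — hence its window displacement is at most `(‖v₀‖ + A)·w_N`, and
only MESSENGERS (large `‖v₀‖`) can carry influence across a mesoscopic corridor. -/
theorem clampLocality {E : Type*} [SeminormedAddCommGroup E] (v₀ : E) {n : ℕ} (Δ : ℕ → E) (A : ℝ)
    (hA : ∑ k ∈ range n, ‖Δ k‖ ≤ A) (m : ℕ) (hm : m ≤ n) :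
    ‖v₀ + ∑ k ∈ range m, Δ k‖ ≤ ‖v₀‖ + A := by
  calc ‖v₀ + ∑ k ∈ range m, Δ k‖ ≤ ‖v₀‖ + ‖∑ k ∈ range m, Δ k‖ := norm_add_le _ _
    _ ≤ ‖v₀‖ + ∑ k ∈ range m, ‖Δ k‖ := add_le_add le_rfl (norm_sum_le _ _)
    _ ≤ ‖v₀‖ + ∑ k ∈ range n, ‖Δ k‖ := add_le_add le_rfl
        (Finset.sum_le_sum_of_subset_of_nonneg (Finset.range_mono hm) (fun _ _ _ => norm_nonneg _))
    _ ≤ ‖v₀‖ + A := add_le_add le_rfl hA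

end Summit.AtomisticToContinuum.HydrodynamicLimit.Cruxes.ClampedCurrentsDock.IdeatorTwo

end
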